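import Literature.NumberTheory.Automorphic.AdelicSchwartzBruhatDecay
import Literature.NumberTheory.Automorphic.IdeleGroupBorel
import HarnessLib

/-!
# Absolute convergence of the mirabolic Eisenstein series of `GL_n` on `re s > 1`

Topic `NumberTheory/Automorphic`; namespace `Literature.NumberTheory.Automorphic`. Proof file
(theorems only) discharging the named fact `summable_mirabolicEisenstein` of
`MirabolicEisensteinSeries`: for a Haar measure `ν` on `𝔸_Kˣ`, `Φ ∈ 𝒮(𝔸_Kⁿ)`, `re s > 1` and
`g ∈ GL_n(𝔸_K)`, every Tate-type integral `∫ Φ(a ξ g) |a|^{ns} dν(a)` converges absolutely and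
`∑_{ξ ∈ ℙ^{n-1}(K)} ∫ |Φ(a ξ g)| |a|^{n re s} dν(a) < ∞` — "This is absolutely convergent for
`Re(s) > 1`" (Cogdell (2004), §2.3, p. 210; Jacquet–Shalika (1981), §4; Godement–Jacquet, LNM 260,
§11). The proof is the classical majorant argument, run on the idele group:

1. **unfolding**: `∑_ξ ∫_{𝔸ˣ} = ∫` of the theta-type series; the idele group is covered by the dyadic
   shells `{‖a‖ ∈ [2^{j-1}, 2^{j+2}]}`, each unfolded over `Kˣ` onto the compact set of
   representatives `Y_r = z(r) P W` of `IdelicDyadicUnfolding`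
   (`lintegral_shell_le_lintegral_dyadicIdeleSet_tsum`), and `(k, ξ Kˣ) ↦ k ξ` is injective into
   `Kⁿ ∖ 0` (`tsum_tsum_smul_rep_le`);
2. **the sup bound** `exists_tsum_enorm_smul_le`: for `y ∈ Y_r`,
   `∑_{ξ ≠ 0} |Φ(y ξ g)| ≤ M (c r)^{-θ} ∑_{ξ ≠ 0, (ξ g)_f ∈ C} ‖(ξ g)_∞‖^{-θ}` for every
   `0 ≤ θ ≤ k`, from the archimedean decay of `Φ` (`AdelicSchwartzBruhatDecay`) and the
   interpolation `(1 + r t)^{-k} ≤ r^{-θ} t^{-θ}` (`AdelicLatticeDecaySums`);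
3. **the lattice sums** `∑ ‖(ξ g)_∞‖^{-θ} < ∞` for `θ > n [K:ℚ]` (`AdelicRationalVectorCount`);
4. **two geometric series** in `j`: `θ = k > n [K:ℚ] σ` for `j ≥ 0` and
   `n [K:ℚ] < θ < n [K:ℚ] σ` for `j < 0`, which is where `σ = re s > 1` enters;
5. linearity in `Φ` (`Submodule.span_induction`) and `∑ ∫ |·| < ∞ ⇒` the two clauses of the fact.

## References

* J. W. Cogdell, *Analytic theory of L-functions for GL_n*, in *An Introduction to the Langlands
  Program* (2004), §2.3, p. 210 [CogdellAnalyticTheory2004].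
* H. Jacquet, J. A. Shalika, *On Euler products and the classification of automorphic
  representations I*, Amer. J. Math. 103 (1981), §4 [JacquetShalikaAJM1981].
* R. Godement, H. Jacquet, *Zeta functions of simple algebras*, LNM 260 (1972), §11
  [GodementJacquetLNM260].
-/

noncomputable section

open scoped NNReal ENNReal Pointwise Classical
open NumberField NumberField.mixedEmbedding IsDedekindDomain Set MeasureTheory Measure Matrix Module

namespace Literature.NumberTheory.Automorphic

variable (K : Type) [Field K] [NumberField K] {n : ℕ}

/-! ### Reindexing `Kˣ × ℙ^{n-1}(K) ↪ Kⁿ ∖ 0` -/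

omit [NumberField K] in
/-- `(k, ξ Kˣ) ↦ k ξ` (with Mathlib's chosen representative `ξ = p.rep`) is injective into the
non-zero vectors, so that `∑_{k ∈ Kˣ} ∑_{p ∈ ℙ(Kⁿ)} f(k p.rep) ≤ ∑_{v ≠ 0} f(v)` for
`f ≥ 0`. [folklore] -/
theorem tsum_tsum_smul_rep_le (f : (Fin n → K) → ℝ≥0∞) :
    ∑' k : Kˣ, ∑' p : Projectivization K (Fin n → K), f ((k : K) • p.rep) ≤
      ∑' v : ↥{v : Fin n → K | v ≠ 0}, f v := by
  set ι : Kˣ × Projectivization K (Fin n → K) → ↥{v : Fin n → K | v ≠ 0} := fun x =>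
    ⟨(x.1 : K) • x.2.rep, smul_ne_zero (Units.ne_zero x.1) x.2.rep_nonzero⟩ with hι
  have hinj : Function.Injective ι := by
    rintro ⟨k, p⟩ ⟨k', p'⟩ h
    have h1 : (k : K) • p.rep = (k' : K) • p'.rep := congrArg Subtype.val h
    have hp : p = p' := by
      rw [← p.mk_rep, ← p'.mk_rep, Projectivization.mk_eq_mk_iff]
      refine ⟨k⁻¹ * k', ?_⟩
      rw [mul_smul, Units.smul_def k', ← h1, ← Units.smul_def, inv_smul_smul]
    subst hp
    have hk : (k : K) = k' := smul_left_injective K p.rep_nonzero h1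
    exact Prod.ext (Units.ext hk) rfl
  rw [show (∑' k : Kˣ, ∑' p : Projectivization K (Fin n → K), f ((k : K) • p.rep)) =
      ∑' x : Kˣ × Projectivization K (Fin n → K), f ((x.1 : K) • x.2.rep) from
    (ENNReal.tsum_prod (f := fun (k : Kˣ) (p : Projectivization K (Fin n → K)) =>
      f ((k : K) • p.rep))).symm]
  exact ENNReal.tsum_comp_le_tsum_of_injective hinj (fun v : ↥{v : Fin n → K | v ≠ 0} => f v)

/-! ### Small lemmas: components of `z(r) q`, and two real-analysis steps -/

/-- `(q⁻¹)_∞ (q_∞ V) = V` in `(K ⊗ ℝ)ⁿ` for an idele `q`. [folklore] -/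
theorem ringEquiv_inv_fst_smul_smul (q : GaloisRepresentations.ideleGroup K) (V : Fin n → mixedSpace K) :
    InfiniteAdeleRing.ringEquiv_mixedSpace K ((q⁻¹ : GaloisRepresentations.ideleGroup K) : AdeleRing (𝓞 K) K).1 •
      (InfiniteAdeleRing.ringEquiv_mixedSpace K (q : AdeleRing (𝓞 K) K).1 • V) = V := by
  have h : ((q⁻¹ : GaloisRepresentations.ideleGroup K) : AdeleRing (𝓞 K) K).1 * (q : AdeleRing (𝓞 K) K).1 = 1 := by
    change (((q⁻¹ : GaloisRepresentations.ideleGroup K) : AdeleRing (𝓞 K) K) * (q : AdeleRing (𝓞 K) K)).1 = 1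
    rw [Units.inv_mul]
    rfl
  rw [← mul_smul, ← map_mul, h, map_one, one_smul]

/-- `(q⁻¹)_f (q_f V) = V` for finite-adelic vectors. [folklore] -/
theorem idele_inv_snd_smul_smul (q : GaloisRepresentations.ideleGroup K)
    (V : Fin n → FiniteAdeleRing (𝓞 K) K) :
    ((q⁻¹ : GaloisRepresentations.ideleGroup K) : AdeleRing (𝓞 K) K).2 • ((q : AdeleRing (𝓞 K) K).2 • V) = V := by
  have h : ((q⁻¹ : GaloisRepresentations.ideleGroup K) : AdeleRing (𝓞 K) K).2 * (q : AdeleRing (𝓞 K) K).2 = 1 := by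
    change (((q⁻¹ : GaloisRepresentations.ideleGroup K) : AdeleRing (𝓞 K) K) * (q : AdeleRing (𝓞 K) K)).2 = 1
    rw [Units.inv_mul]
    rfl
  rw [← mul_smul, h, one_smul]

/-- Archimedean coordinates of `(z(r) q) x`: `r · q_∞ x_∞`. [folklore] -/
theorem vecInfinitePart_posRealIdele_mul_smul (r : ℝ≥0ˣ) (q : GaloisRepresentations.ideleGroup K)
    (x : Fin n → AdeleRing (𝓞 K) K) :
    vecInfinitePart K n (((posRealIdele K r * q : GaloisRepresentations.ideleGroup K) : AdeleRing (𝓞 K) K) • x) =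
      ((r : ℝ≥0) : ℝ) • (InfiniteAdeleRing.ringEquiv_mixedSpace K (q : AdeleRing (𝓞 K) K).1 •
        vecInfinitePart K n x) := by
  rw [Units.val_mul, mul_smul, vecInfinitePart_posRealIdele_smul, vecInfinitePart_smul]

/-- Finite coordinates of `(z(r) q) x`: `q_f x_f`. [folklore] -/
theorem vecFinitePart_posRealIdele_mul_smul (r : ℝ≥0ˣ) (q : GaloisRepresentations.ideleGroup K)
    (x : Fin n → AdeleRing (𝓞 K) K) :
    vecFinitePart K n (((posRealIdele K r * q : GaloisRepresentations.ideleGroup K) : AdeleRing (𝓞 K) K) • x) =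
      (q : AdeleRing (𝓞 K) K).2 • vecFinitePart K n x := by
  rw [Units.val_mul, mul_smul, vecFinitePart_smul, vecFinitePart_smul, posRealIdele_snd, one_smul]

omit [NumberField K] in
/-- The real-analysis step of the sup bound: from `a ≤ M (1 + X)^{-k}`, `ρ t ≤ X` and
`0 ≤ θ ≤ k` conclude `a ≤ M ρ^{-θ} t^{-θ}`. [folklore] -/
theorem le_mul_rpow_neg_mul_rpow_neg {a M X ρ t θ : ℝ} {k : ℕ} (hM0 : 0 ≤ M)
    (h : a ≤ M * (1 + X) ^ (-(k : ℝ))) (hρ : 0 < ρ) (ht : 0 < t) (hlow : ρ * t ≤ X)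
    (hθ0 : 0 ≤ θ) (hθk : θ ≤ k) : a ≤ M * ρ ^ (-θ) * t ^ (-θ) := by
  have hρt : 0 < ρ * t := mul_pos hρ ht
  have h1 : (1 + X) ^ (-(k : ℝ)) ≤ (1 + ρ * t) ^ (-(k : ℝ)) :=
    Real.rpow_le_rpow_of_nonpos (by linarith) (by linarith) (neg_nonpos.2 (Nat.cast_nonneg k))
  have h2 := one_add_mul_rpow_neg_le hρ ht hθ0 hθk
  calc a ≤ M * (1 + X) ^ (-(k : ℝ)) := h
    _ ≤ M * (ρ ^ (-θ) * t ^ (-θ)) := mul_le_mul_of_nonneg_left (h1.trans h2) hM0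
    _ = M * ρ ^ (-θ) * t ^ (-θ) := (mul_assoc _ _ _).symm

omit [NumberField K] in
/-- The same in `ℝ≥0∞`: `‖z‖ₑ ≤ ofReal (M ρ^{-θ}) · ofReal (t^{-θ})`. [folklore] -/
theorem enorm_le_ofReal_mul_ofReal {z : ℂ} {M ρ t θ : ℝ} (hM0 : 0 ≤ M) (hρ : 0 < ρ)
    (h : ‖z‖ ≤ M * ρ ^ (-θ) * t ^ (-θ)) :
    (‖z‖ₑ : ℝ≥0∞) ≤ ENNReal.ofReal (M * ρ ^ (-θ)) * ENNReal.ofReal (t ^ (-θ)) := by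
  rw [← ofReal_norm, ← ENNReal.ofReal_mul (mul_nonneg hM0 (Real.rpow_nonneg hρ.le _))]
  exact ENNReal.ofReal_le_ofReal h

/-! ### The sup bound on the dyadic sets of representatives -/

/-- **The sup bound.** Let `Φ` be a standard Schwartz–Bruhat function on `𝔸_Kⁿ`, `g ∈ GL_n(𝔸_K)`
and `k ∈ ℕ`. There are `M ≥ 0`, `c > 0` and a compact set `C` of finite-adelic vectors such that
for every `0 ≤ θ ≤ k`, every `r > 0` and every `y` in the dyadic set of representatives
`Y_r = z(r) P W` (`dyadicIdeleSet`),
`∑_{ξ ∈ Kⁿ ∖ 0} |Φ(y ξ g)| ≤ M (c r)^{-θ} ∑_{ξ ≠ 0, (ξ g)_f ∈ C} ‖(ξ g)_∞‖^{-θ}`: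
the archimedean coordinates of `y ∈ Y_r` are `≥ c r` in size and its finite coordinates lie in
a fixed compact set, so `|Φ(y ξ g)| ≤ M (1 + c r ‖(ξ g)_∞‖)^{-k} 𝟙_C((ξ g)_f)`
(`IsStandardSchwartzBruhat.exists_norm_le_rpow_neg`, `exists_isCompact_eq_zero`), and
`(1 + c r t)^{-k} ≤ (c r)^{-θ} t^{-θ}` (`one_add_mul_rpow_neg_le`). (Godement–Jacquet (1972),
proof of Lemma 11.5; Jacquet–Shalika (1981), §4.) [cite: GodementJacquetLNM260, §11] -/
theorem exists_tsum_enorm_smul_le (g : GL (Fin n) (AdeleRing (𝓞 K) K))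
    {Φ : (Fin n → AdeleRing (𝓞 K) K) → ℂ} (hΦ : IsStandardSchwartzBruhat K n Φ) (k : ℕ) :
    ∃ (M c : ℝ) (C : Set (Fin n → FiniteAdeleRing (𝓞 K) K)), 0 ≤ M ∧ 0 < c ∧ IsCompact C ∧
      ∀ θ : ℝ, 0 ≤ θ → θ ≤ k → ∀ r : ℝ≥0ˣ, ∀ y ∈ dyadicIdeleSet K r,
        ∑' v : ↥{v : Fin n → K | v ≠ 0},
            ‖Φ (((y : (AdeleRing (𝓞 K) K)ˣ) : AdeleRing (𝓞 K) K) •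
              (ratVec K (v : Fin n → K) ᵥ* (g : Matrix (Fin n) (Fin n) (AdeleRing (𝓞 K) K))))‖ₑ ≤
          ENNReal.ofReal (M * (c * ((r : ℝ≥0) : ℝ)) ^ (-θ)) *
            ∑' v : ↥{v : Fin n → K | v ≠ 0 ∧
                vecFinitePart K n (ratVec K v ᵥ* (g : Matrix (Fin n) (Fin n) (AdeleRing (𝓞 K) K))) ∈ C},
              ENNReal.ofReal (‖vecInfinitePart K n (ratVec K (v : Fin n → K) ᵥ*
                (g : Matrix (Fin n) (Fin n) (AdeleRing (𝓞 K) K)))‖ ^ (-θ)) := by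
  obtain ⟨M, hM0, hM⟩ := hΦ.exists_norm_le_rpow_neg k
  obtain ⟨Cf, hCfc, hCf⟩ := hΦ.exists_isCompact_eq_zero
  -- the compact set `Q = P W` and a bound `B` for `‖(q⁻¹)_∞‖`, `q ∈ Q`
  set Q : Set (GaloisRepresentations.ideleGroup K) := posRealIdeleSegment K * normOneIdeleCover K
    with hQ
  have hQc : IsCompact Q := (isCompact_posRealIdeleSegment K).mul (isCompact_normOneIdeleCover K)
  have hcont : Continuous fun q : GaloisRepresentations.ideleGroup K =>
      InfiniteAdeleRing.ringEquiv_mixedSpace K ((q⁻¹ : GaloisRepresentations.ideleGroup K) : AdeleRing (𝓞 K) K).1 :=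
    (continuous_ringEquiv_mixedSpace K).comp (continuous_fst.comp Units.continuous_coe_inv)
  obtain ⟨B, hB⟩ := hQc.exists_bound_of_continuousOn hcont.continuousOn
  set B' : ℝ := max B 1 with hB'
  have hB'1 : 1 ≤ B' := le_max_right _ _
  have hB'0 : 0 < B' := one_pos.trans_le hB'1
  have hBq : ∀ q ∈ Q, ‖InfiniteAdeleRing.ringEquiv_mixedSpace K
      ((q⁻¹ : GaloisRepresentations.ideleGroup K) : AdeleRing (𝓞 K) K).1‖ ≤ B' :=
    fun q hq => (hB q hq).trans (le_max_left _ _)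
  -- the compact set of finite parts
  set F : GaloisRepresentations.ideleGroup K × (Fin n → FiniteAdeleRing (𝓞 K) K) →
      (Fin n → FiniteAdeleRing (𝓞 K) K) := fun p =>
    ((p.1⁻¹ : GaloisRepresentations.ideleGroup K) : AdeleRing (𝓞 K) K).2 • p.2 with hF
  have hFc : Continuous F :=
    (continuous_snd.comp (Units.continuous_coe_inv.comp continuous_fst)).smul continuous_snd
  set C : Set (Fin n → FiniteAdeleRing (𝓞 K) K) := F '' (Q ×ˢ Cf) with hC
  have hCc : IsCompact C := (hQc.prod hCfc).image hFc
  refine ⟨M, B'⁻¹, C, hM0, inv_pos.2 hB'0, hCc, fun θ hθ0 hθk r y hy => ?_⟩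
  obtain ⟨q, hq, rfl⟩ := Set.mem_smul_set.1 hy
  rw [smul_eq_mul]
  have hr0 : 0 < ((r : ℝ≥0) : ℝ) := NNReal.coe_pos.2 (pos_iff_ne_zero.2 r.ne_zero)
  have hrB : 0 < B'⁻¹ * ((r : ℝ≥0) : ℝ) := mul_pos (inv_pos.2 hB'0) hr0
  -- notation for the lattice data
  set Λ : Set (Fin n → K) := {v : Fin n → K | v ≠ 0 ∧
    vecFinitePart K n (ratVec K v ᵥ* (g : Matrix (Fin n) (Fin n) (AdeleRing (𝓞 K) K))) ∈ C} with hΛ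
  set N : (Fin n → K) → ℝ := fun v =>
    ‖vecInfinitePart K n (ratVec K v ᵥ* (g : Matrix (Fin n) (Fin n) (AdeleRing (𝓞 K) K)))‖ with hN
  set A : ℝ≥0∞ := ENNReal.ofReal (M * (B'⁻¹ * ((r : ℝ≥0) : ℝ)) ^ (-θ)) with hA
  set G : (Fin n → K) → ℝ≥0∞ := fun v => A * ENNReal.ofReal (N v ^ (-θ)) with hG
  -- pointwise bound
  have hpt : ∀ v : Fin n → K, v ≠ 0 →
      (‖Φ (((posRealIdele K r * q : GaloisRepresentations.ideleGroup K) : AdeleRing (𝓞 K) K) •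
        (ratVec K v ᵥ* (g : Matrix (Fin n) (Fin n) (AdeleRing (𝓞 K) K))))‖ₑ : ℝ≥0∞) ≤
        Λ.indicator G v := by
    intro v hv
    by_cases hvΛ : v ∈ Λ
    · rw [indicator_of_mem hvΛ]
      have hNpos : 0 < N v := norm_vecInfinitePart_ratVec_vecMul_pos K hv g
      have hlow : B'⁻¹ * ((r : ℝ≥0) : ℝ) * N v ≤
          ‖vecInfinitePart K n (((posRealIdele K r * q : GaloisRepresentations.ideleGroup K) :
            AdeleRing (𝓞 K) K) • (ratVec K v ᵥ* (g : Matrix (Fin n) (Fin n) (AdeleRing (𝓞 K) K))))‖ := by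
        rw [vecInfinitePart_posRealIdele_mul_smul, _root_.norm_smul, Real.norm_of_nonneg hr0.le,
          mul_assoc, mul_left_comm]
        refine mul_le_mul_of_nonneg_left ?_ hr0.le
        rw [inv_mul_le_iff₀ hB'0]
        calc N v = ‖InfiniteAdeleRing.ringEquiv_mixedSpace K
              ((q⁻¹ : GaloisRepresentations.ideleGroup K) : AdeleRing (𝓞 K) K).1 •
              (InfiniteAdeleRing.ringEquiv_mixedSpace K (q : AdeleRing (𝓞 K) K).1 •
                vecInfinitePart K n (ratVec K v ᵥ* (g : Matrix (Fin n) (Fin n) (AdeleRing (𝓞 K) K))))‖ := by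
              rw [ringEquiv_inv_fst_smul_smul]
          _ ≤ ‖InfiniteAdeleRing.ringEquiv_mixedSpace K
              ((q⁻¹ : GaloisRepresentations.ideleGroup K) : AdeleRing (𝓞 K) K).1‖ *
              ‖InfiniteAdeleRing.ringEquiv_mixedSpace K (q : AdeleRing (𝓞 K) K).1 •
                vecInfinitePart K n (ratVec K v ᵥ* (g : Matrix (Fin n) (Fin n) (AdeleRing (𝓞 K) K)))‖ :=
              norm_smul_le _ _
          _ ≤ B' * ‖InfiniteAdeleRing.ringEquiv_mixedSpace K (q : AdeleRing (𝓞 K) K).1 •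
                vecInfinitePart K n (ratVec K v ᵥ* (g : Matrix (Fin n) (Fin n) (AdeleRing (𝓞 K) K)))‖ :=
              mul_le_mul_of_nonneg_right (hBq q hq) (norm_nonneg _)
      exact enorm_le_ofReal_mul_ofReal hM0 hrB
        (le_mul_rpow_neg_mul_rpow_neg hM0 (hM _) hrB hNpos hlow hθ0 hθk)
    · rw [indicator_of_notMem hvΛ]
      have hnot : vecFinitePart K n (ratVec K v ᵥ* (g : Matrix (Fin n) (Fin n) (AdeleRing (𝓞 K) K))) ∉ C :=
        fun h => hvΛ ⟨hv, h⟩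
      have hzero : Φ (((posRealIdele K r * q : GaloisRepresentations.ideleGroup K) : AdeleRing (𝓞 K) K) •
          (ratVec K v ᵥ* (g : Matrix (Fin n) (Fin n) (AdeleRing (𝓞 K) K)))) = 0 := by
        refine hCf _ fun hmem => hnot ?_
        rw [vecFinitePart_posRealIdele_mul_smul] at hmem
        rw [← idele_inv_snd_smul_smul K q
          (vecFinitePart K n (ratVec K v ᵥ* (g : Matrix (Fin n) (Fin n) (AdeleRing (𝓞 K) K))))]
        exact ⟨(q, (q : AdeleRing (𝓞 K) K).2 •
          vecFinitePart K n (ratVec K v ᵥ* (g : Matrix (Fin n) (Fin n) (AdeleRing (𝓞 K) K)))),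
          ⟨hq, hmem⟩, rfl⟩
      rw [hzero, enorm_zero]
  -- summation
  have hΛsub : {v : Fin n → K | v ≠ 0} ∩ Λ = Λ := Set.inter_eq_right.2 fun v hv => hv.1
  calc ∑' v : ↥{v : Fin n → K | v ≠ 0},
        (‖Φ (((posRealIdele K r * q : GaloisRepresentations.ideleGroup K) : AdeleRing (𝓞 K) K) •
          (ratVec K (v : Fin n → K) ᵥ* (g : Matrix (Fin n) (Fin n) (AdeleRing (𝓞 K) K))))‖ₑ : ℝ≥0∞)
      ≤ ∑' v : ↥{v : Fin n → K | v ≠ 0}, Λ.indicator G v :=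
        ENNReal.tsum_le_tsum fun v => hpt v.1 v.2
    _ = ∑' v : Fin n → K, {v : Fin n → K | v ≠ 0}.indicator (Λ.indicator G) v :=
        tsum_subtype {v : Fin n → K | v ≠ 0} (Λ.indicator G)
    _ = ∑' v : Fin n → K, Λ.indicator G v := by rw [Set.indicator_indicator, hΛsub]
    _ = ∑' v : Λ, G v := (tsum_subtype Λ G).symm
    _ = A * ∑' v : Λ, ENNReal.ofReal (N v ^ (-θ)) := by
        simp only [hG]
        exact ENNReal.tsum_mul_left

/-! ### Measurability and small algebra on the idele group -/

/-- `ℙ^{n-1}(K)` is countable (a quotient of the countable set of non-zero vectors). [folklore] -/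
theorem countable_projectivization : Countable (Projectivization K (Fin n → K)) := by
  haveI := countable_numberField K
  exact Function.Surjective.countable
    (f := fun v : {v : Fin n → K // v ≠ 0} => Projectivization.mk K v.1 v.2)
    fun p => ⟨⟨p.rep, p.rep_nonzero⟩, p.mk_rep⟩

/-- The majorant `a ↦ |Φ(a x)| · |a|^τ` is measurable on `𝔸_Kˣ` for continuous `Φ`. [folklore] -/
theorem measurable_enorm_apply_smul_mul [MeasurableSpace (AdeleRing (𝓞 K) K)]
    [BorelSpace (AdeleRing (𝓞 K) K)] {Φ : (Fin n → AdeleRing (𝓞 K) K) → ℂ} (hΦc : Continuous Φ)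
    (x : Fin n → AdeleRing (𝓞 K) K) (τ : ℝ) :
    Measurable fun a : GaloisRepresentations.ideleGroup K =>
      (‖Φ ((a : AdeleRing (𝓞 K) K) • x)‖ₑ : ℝ≥0∞) *
        ENNReal.ofReal ((IdeleClassGroup.ideleNorm K a : ℝ) ^ τ) := by
  haveI := borelSpace_ideleGroup K
  have hc : Continuous fun a : GaloisRepresentations.ideleGroup K => (IdeleClassGroup.ideleNorm K a : ℝ) :=
    NNReal.continuous_coe.comp (continuous_ideleNorm_holds K)
  refine ((hΦc.comp (Units.continuous_val.smul continuous_const)).measurable.enorm).mul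
    (ENNReal.measurable_ofReal.comp ?_)
  exact (hc.rpow_const fun a => Or.inl (NNReal.coe_ne_zero.2 (ideleNorm_ne_zero a))).measurable

/-- The theta-type majorant `a ↦ ∑_p |Φ(a x_p)| |a|^τ` is measurable. [folklore] -/
theorem measurable_tsum_enorm_apply_smul_mul [MeasurableSpace (AdeleRing (𝓞 K) K)]
    [BorelSpace (AdeleRing (𝓞 K) K)] {Φ : (Fin n → AdeleRing (𝓞 K) K) → ℂ} (hΦc : Continuous Φ)
    (x : Projectivization K (Fin n → K) → Fin n → AdeleRing (𝓞 K) K) (τ : ℝ) :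
    Measurable fun a : GaloisRepresentations.ideleGroup K =>
      ∑' p : Projectivization K (Fin n → K), (‖Φ ((a : AdeleRing (𝓞 K) K) • x p)‖ₑ : ℝ≥0∞) *
        ENNReal.ofReal ((IdeleClassGroup.ideleNorm K a : ℝ) ^ τ) := by
  haveI := countable_projectivization K (n := n)
  have h := fun p => measurable_enorm_apply_smul_mul K hΦc (x p) τ
  simp_rw [ENNReal.tsum_eq_iSup_sum]
  exact Measurable.iSup fun s => s.measurable_fun_sum fun p _ => h p

/-- Principal ideles have idele norm `1` (product formula, `ideleNorm_principal`). [folklore] -/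
theorem ideleNorm_principalIdele_eq_one (k : Kˣ) :
    IdeleClassGroup.ideleNorm K (principalIdele K k) = 1 :=
  ideleNorm_principal ⟨k, rfl⟩

/-- `k (ξ g) = (k ξ) g` for a principal idele `k` and a principal vector `ξ`. [folklore] -/
theorem principalIdele_smul_ratVec_vecMul (k : Kˣ) (ξ : Fin n → K)
    (g : Matrix (Fin n) (Fin n) (AdeleRing (𝓞 K) K)) :
    ((principalIdele K k : GaloisRepresentations.ideleGroup K) : AdeleRing (𝓞 K) K) • (ratVec K ξ ᵥ* g) =
      ratVec K ((k : K) • ξ) ᵥ* g := by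
  rw [ratVec_smul, Matrix.smul_vecMul]
  rfl

/-! ### The estimate on one dyadic shell -/

/-- **One dyadic shell.** For a left-invariant measure `ν` on `𝔸_Kˣ`, a continuous `Φ`, `τ ≥ 0`
and the sup bound of `exists_tsum_enorm_smul_le` (constants `M, c`, set `C`, order `k`), for
every `0 ≤ θ ≤ k` and `r > 0`:
`∫_{‖a‖ ∈ [r^d/2, 4 r^d]} ∑_p |Φ(a ξ_p g)| |a|^τ dν ≤
  ν(P W) · (4 r^d)^τ M (c r)^{-θ} · ∑_{ξ ≠ 0, (ξ g)_f ∈ C} ‖(ξ g)_∞‖^{-θ}`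
(unfold the shell over `Kˣ` onto `Y_r`, `lintegral_shell_le_lintegral_dyadicIdeleSet_tsum`;
`|k y| = |y| ≤ 4 r^d`; reindex `(k, p) ↦ k p.rep`, `tsum_tsum_smul_rep_le`; apply the sup bound;
`ν(Y_r) = ν(P W)`, `measure_dyadicIdeleSet`). [cite: GodementJacquetLNM260, §11] -/
theorem setLIntegral_shell_le [MeasurableSpace (AdeleRing (𝓞 K) K)] [BorelSpace (AdeleRing (𝓞 K) K)]
    (ν : Measure (GaloisRepresentations.ideleGroup K)) [ν.IsMulLeftInvariant]
    (g : GL (Fin n) (AdeleRing (𝓞 K) K)) {Φ : (Fin n → AdeleRing (𝓞 K) K) → ℂ} (hΦc : Continuous Φ)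
    {M c : ℝ} {C : Set (Fin n → FiniteAdeleRing (𝓞 K) K)} {k : ℕ}
    (hsup : ∀ θ : ℝ, 0 ≤ θ → θ ≤ k → ∀ r : ℝ≥0ˣ, ∀ y ∈ dyadicIdeleSet K r,
        ∑' v : ↥{v : Fin n → K | v ≠ 0},
            ‖Φ (((y : (AdeleRing (𝓞 K) K)ˣ) : AdeleRing (𝓞 K) K) •
              (ratVec K (v : Fin n → K) ᵥ* (g : Matrix (Fin n) (Fin n) (AdeleRing (𝓞 K) K))))‖ₑ ≤
          ENNReal.ofReal (M * (c * ((r : ℝ≥0) : ℝ)) ^ (-θ)) *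
            ∑' v : ↥{v : Fin n → K | v ≠ 0 ∧
                vecFinitePart K n (ratVec K v ᵥ* (g : Matrix (Fin n) (Fin n) (AdeleRing (𝓞 K) K))) ∈ C},
              ENNReal.ofReal (‖vecInfinitePart K n (ratVec K (v : Fin n → K) ᵥ*
                (g : Matrix (Fin n) (Fin n) (AdeleRing (𝓞 K) K)))‖ ^ (-θ)))
    {τ : ℝ} (hτ : 0 ≤ τ) {θ : ℝ} (hθ0 : 0 ≤ θ) (hθk : θ ≤ k) (r : ℝ≥0ˣ) :
    ∫⁻ a in {x : GaloisRepresentations.ideleGroup K |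
        ((r : ℝ≥0) : ℝ) ^ finrank ℚ K / 2 ≤ (IdeleClassGroup.ideleNorm K x : ℝ) ∧
          (IdeleClassGroup.ideleNorm K x : ℝ) ≤ 4 * ((r : ℝ≥0) : ℝ) ^ finrank ℚ K},
      ∑' p : Projectivization K (Fin n → K),
        (‖Φ ((a : AdeleRing (𝓞 K) K) •
          (ratVec K p.rep ᵥ* (g : Matrix (Fin n) (Fin n) (AdeleRing (𝓞 K) K))))‖ₑ : ℝ≥0∞) *
          ENNReal.ofReal ((IdeleClassGroup.ideleNorm K a : ℝ) ^ τ) ∂ν ≤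
      ν (posRealIdeleSegment K * normOneIdeleCover K) *
        ENNReal.ofReal ((4 * ((r : ℝ≥0) : ℝ) ^ finrank ℚ K) ^ τ * (M * (c * ((r : ℝ≥0) : ℝ)) ^ (-θ))) *
        ∑' v : ↥{v : Fin n → K | v ≠ 0 ∧
            vecFinitePart K n (ratVec K v ᵥ* (g : Matrix (Fin n) (Fin n) (AdeleRing (𝓞 K) K))) ∈ C},
          ENNReal.ofReal (‖vecInfinitePart K n (ratVec K (v : Fin n → K) ᵥ*
            (g : Matrix (Fin n) (Fin n) (AdeleRing (𝓞 K) K)))‖ ^ (-θ)) := by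
  haveI := borelSpace_ideleGroup K
  -- notation
  set Z : ℝ≥0∞ := ∑' v : ↥{v : Fin n → K | v ≠ 0 ∧
      vecFinitePart K n (ratVec K v ᵥ* (g : Matrix (Fin n) (Fin n) (AdeleRing (𝓞 K) K))) ∈ C},
    ENNReal.ofReal (‖vecInfinitePart K n (ratVec K (v : Fin n → K) ᵥ*
      (g : Matrix (Fin n) (Fin n) (AdeleRing (𝓞 K) K)))‖ ^ (-θ)) with hZ
  set F : GaloisRepresentations.ideleGroup K → ℝ≥0∞ := fun a =>
    ∑' p : Projectivization K (Fin n → K),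
      (‖Φ ((a : AdeleRing (𝓞 K) K) •
        (ratVec K p.rep ᵥ* (g : Matrix (Fin n) (Fin n) (AdeleRing (𝓞 K) K))))‖ₑ : ℝ≥0∞) *
        ENNReal.ofReal ((IdeleClassGroup.ideleNorm K a : ℝ) ^ τ) with hF
  have hFm : Measurable F := measurable_tsum_enorm_apply_smul_mul K hΦc _ τ
  set bound : ℝ≥0∞ :=
    ENNReal.ofReal ((4 * ((r : ℝ≥0) : ℝ) ^ finrank ℚ K) ^ τ * (M * (c * ((r : ℝ≥0) : ℝ)) ^ (-θ))) * Z
    with hbound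
  -- the pointwise bound on `Y_r`
  have hpt : ∀ y ∈ dyadicIdeleSet K r, ∑' k : Kˣ, F (principalIdele K k * y) ≤ bound := by
    intro y hy
    have hnorm1 : ∀ k : Kˣ, IdeleClassGroup.ideleNorm K (principalIdele K k * y) =
        IdeleClassGroup.ideleNorm K y := fun k => by
      rw [map_mul, ideleNorm_principalIdele_eq_one, one_mul]
    have hterm : ∀ (k : Kˣ) (p : Projectivization K (Fin n → K)),
        (‖Φ (((principalIdele K k * y : GaloisRepresentations.ideleGroup K) : AdeleRing (𝓞 K) K) •
          (ratVec K p.rep ᵥ* (g : Matrix (Fin n) (Fin n) (AdeleRing (𝓞 K) K))))‖ₑ : ℝ≥0∞) *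
          ENNReal.ofReal ((IdeleClassGroup.ideleNorm K (principalIdele K k * y) : ℝ) ^ τ) =
        (‖Φ ((y : AdeleRing (𝓞 K) K) •
          (ratVec K ((k : K) • p.rep) ᵥ* (g : Matrix (Fin n) (Fin n) (AdeleRing (𝓞 K) K))))‖ₑ : ℝ≥0∞) *
          ENNReal.ofReal ((IdeleClassGroup.ideleNorm K y : ℝ) ^ τ) := by
      intro k p
      rw [hnorm1, Units.val_mul, mul_comm ((principalIdele K k : GaloisRepresentations.ideleGroup K) :
        AdeleRing (𝓞 K) K), mul_smul, principalIdele_smul_ratVec_vecMul]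
    have hy4 : (IdeleClassGroup.ideleNorm K y : ℝ) ^ τ ≤ (4 * ((r : ℝ≥0) : ℝ) ^ finrank ℚ K) ^ τ :=
      Real.rpow_le_rpow (NNReal.coe_nonneg _) (ideleNorm_mem_of_mem_dyadicIdeleSet K hy).2 hτ
    calc ∑' k : Kˣ, F (principalIdele K k * y)
        = ∑' k : Kˣ, ∑' p : Projectivization K (Fin n → K),
            (‖Φ ((y : AdeleRing (𝓞 K) K) •
              (ratVec K ((k : K) • p.rep) ᵥ* (g : Matrix (Fin n) (Fin n) (AdeleRing (𝓞 K) K))))‖ₑ : ℝ≥0∞) *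
              ENNReal.ofReal ((IdeleClassGroup.ideleNorm K y : ℝ) ^ τ) := by
          simp only [hF, hterm]
      _ = (∑' k : Kˣ, ∑' p : Projectivization K (Fin n → K),
            (‖Φ ((y : AdeleRing (𝓞 K) K) •
              (ratVec K ((k : K) • p.rep) ᵥ* (g : Matrix (Fin n) (Fin n) (AdeleRing (𝓞 K) K))))‖ₑ : ℝ≥0∞)) *
            ENNReal.ofReal ((IdeleClassGroup.ideleNorm K y : ℝ) ^ τ) := by
          rw [← ENNReal.tsum_mul_right]
          refine tsum_congr fun k => ?_
          rw [ENNReal.tsum_mul_right]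
      _ ≤ (∑' v : ↥{v : Fin n → K | v ≠ 0},
            (‖Φ ((y : AdeleRing (𝓞 K) K) •
              (ratVec K (v : Fin n → K) ᵥ* (g : Matrix (Fin n) (Fin n) (AdeleRing (𝓞 K) K))))‖ₑ : ℝ≥0∞)) *
            ENNReal.ofReal ((4 * ((r : ℝ≥0) : ℝ) ^ finrank ℚ K) ^ τ) :=
          mul_le_mul' (tsum_tsum_smul_rep_le K fun v =>
            (‖Φ ((y : AdeleRing (𝓞 K) K) •
              (ratVec K v ᵥ* (g : Matrix (Fin n) (Fin n) (AdeleRing (𝓞 K) K))))‖ₑ : ℝ≥0∞))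
            (ENNReal.ofReal_le_ofReal hy4)
      _ ≤ (ENNReal.ofReal (M * (c * ((r : ℝ≥0) : ℝ)) ^ (-θ)) * Z) *
            ENNReal.ofReal ((4 * ((r : ℝ≥0) : ℝ) ^ finrank ℚ K) ^ τ) :=
          mul_le_mul' (hsup θ hθ0 hθk r y hy) le_rfl
      _ = bound := by
          rw [hbound, ENNReal.ofReal_mul (Real.rpow_nonneg (by positivity) _)]
          ring
  calc ∫⁻ a in {x : GaloisRepresentations.ideleGroup K |
        ((r : ℝ≥0) : ℝ) ^ finrank ℚ K / 2 ≤ (IdeleClassGroup.ideleNorm K x : ℝ) ∧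
          (IdeleClassGroup.ideleNorm K x : ℝ) ≤ 4 * ((r : ℝ≥0) : ℝ) ^ finrank ℚ K}, F a ∂ν
      ≤ ∫⁻ y in dyadicIdeleSet K r, ∑' k : Kˣ, F (principalIdele K k * y) ∂ν :=
        lintegral_shell_le_lintegral_dyadicIdeleSet_tsum K ν r hFm
    _ ≤ ∫⁻ y in dyadicIdeleSet K r, bound ∂ν :=
        setLIntegral_mono' (measurableSet_dyadicIdeleSet K r) fun y hy => hpt y hy
    _ = bound * ν (dyadicIdeleSet K r) := setLIntegral_const _ _
    _ = ν (posRealIdeleSegment K * normOneIdeleCover K) *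
        ENNReal.ofReal ((4 * ((r : ℝ≥0) : ℝ) ^ finrank ℚ K) ^ τ * (M * (c * ((r : ℝ≥0) : ℝ)) ^ (-θ))) * Z := by
        rw [measure_dyadicIdeleSet, hbound]
        ring

/-! ### Bookkeeping of the exponents and the two geometric series -/

/-- The constant on the `j`-th shell, `r_j = 2^{j/d}`:
`(4 r_j^d)^τ · M (c r_j)^{-θ} = 4^τ M c^{-θ} · 2^{j (τ - θ/d)}`. [folklore] -/
theorem shell_const_eq {c : ℝ} (hc : 0 < c) (M τ θ : ℝ) {d : ℕ} (hd : 0 < d) (j : ℤ) :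
    (4 * ((2 : ℝ) ^ ((j : ℝ) / d)) ^ d) ^ τ * (M * (c * (2 : ℝ) ^ ((j : ℝ) / d)) ^ (-θ)) =
      4 ^ τ * M * c ^ (-θ) * (2 : ℝ) ^ ((j : ℝ) * (τ - θ / d)) := by
  have h2 : (0 : ℝ) ≤ 2 := by norm_num
  have hpow : ((2 : ℝ) ^ ((j : ℝ) / d)) ^ d = (2 : ℝ) ^ (j : ℝ) := by
    rw [← Real.rpow_natCast, ← Real.rpow_mul h2, div_mul_cancel₀ _ (Nat.cast_ne_zero.2 hd.ne')]
  rw [hpow, Real.mul_rpow (by norm_num) (Real.rpow_nonneg h2 _), ← Real.rpow_mul h2,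
    Real.mul_rpow hc.le (Real.rpow_nonneg h2 _), ← Real.rpow_mul h2]
  have hexp : (2 : ℝ) ^ ((j : ℝ) * τ) * (2 : ℝ) ^ ((j : ℝ) / d * -θ) =
      (2 : ℝ) ^ ((j : ℝ) * (τ - θ / d)) := by
    rw [← Real.rpow_add (by norm_num : (0 : ℝ) < 2)]
    congr 1
    ring
  calc (4 : ℝ) ^ τ * (2 : ℝ) ^ ((j : ℝ) * τ) * (M * (c ^ (-θ) * (2 : ℝ) ^ ((j : ℝ) / d * -θ)))
      = 4 ^ τ * M * c ^ (-θ) * ((2 : ℝ) ^ ((j : ℝ) * τ) * (2 : ℝ) ^ ((j : ℝ) / d * -θ)) := by ring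
    _ = 4 ^ τ * M * c ^ (-θ) * (2 : ℝ) ^ ((j : ℝ) * (τ - θ / d)) := by rw [hexp]

/-- A geometric series of shell bounds is finite:
`∑_m V · (A ρ^m) · Z < ∞` for `V, Z < ∞`, `A ≥ 0`, `0 ≤ ρ < 1`. [folklore] -/
theorem tsum_mul_ofReal_mul_pow_mul_lt_top {V Z : ℝ≥0∞} (hV : V ≠ ⊤) (hZ : Z ≠ ⊤) {A ρ : ℝ}
    (hA : 0 ≤ A) (hρ0 : 0 ≤ ρ) (hρ1 : ρ < 1) :
    ∑' m : ℕ, V * ENNReal.ofReal (A * ρ ^ m) * Z < ⊤ := by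
  have h1 : ∑' m : ℕ, V * ENNReal.ofReal (A * ρ ^ m) * Z =
      V * (ENNReal.ofReal A * ∑' m : ℕ, ENNReal.ofReal ρ ^ m) * Z := by
    simp_rw [ENNReal.ofReal_mul hA, ENNReal.ofReal_pow hρ0]
    rw [ENNReal.tsum_mul_right, ENNReal.tsum_mul_left, ENNReal.tsum_mul_left]
  rw [h1, ENNReal.tsum_geometric]
  have hρ' : (1 - ENNReal.ofReal ρ)⁻¹ < ⊤ :=
    ENNReal.inv_lt_top.2 (tsub_pos_iff_lt.2 (ENNReal.ofReal_lt_one.2 hρ1))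
  exact ENNReal.mul_lt_top (ENNReal.mul_lt_top hV.lt_top
    (ENNReal.mul_lt_top ENNReal.ofReal_lt_top hρ')) hZ.lt_top


/-! ### The majorant series for a standard Schwartz–Bruhat function -/

/-- **The majorant is finite for standard `Φ` and `σ > 1`.** For a Haar measure `ν` on `𝔸_Kˣ`,
`g ∈ GL_n(𝔸_K)`, a standard Schwartz–Bruhat function `Φ` and `σ > 1`,
`∑_{p ∈ ℙ^{n-1}(K)} ∫_{𝔸_Kˣ} |Φ(a ξ_p g)| |a|^{nσ} dν(a) < ∞`.
Proof: Tonelli; cover `𝔸_Kˣ` by the shells `‖a‖ ∈ [2^{j-1}, 2^{j+2}]` (`r_j = 2^{j/[K:ℚ]}`); bound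
each shell by `setLIntegral_shell_le` with `θ = k = ⌊n [K:ℚ] σ⌋ + 1` for `j ≥ 0` and
`θ = n [K:ℚ] (1 + σ)/2 ∈ (n [K:ℚ], n [K:ℚ] σ)` for `j < 0`, where the lattice sums are finite
(`tsum_norm_vecInfinitePart_rpow_neg_lt_top`); the two resulting series in `j` are geometric with
ratios `2^{nσ - k/[K:ℚ]} < 1` and `2^{-(nσ - θ/[K:ℚ])} < 1`. (Godement–Jacquet (1972), Lemma 11.5
and Prop. 11.7; Jacquet–Shalika (1981), §4; Cogdell (2004), §2.3.)
[cite: GodementJacquetLNM260, §11] -/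
theorem tsum_lintegral_enorm_smul_lt_top [MeasurableSpace (AdeleRing (𝓞 K) K)]
    [BorelSpace (AdeleRing (𝓞 K) K)] (ν : Measure (GaloisRepresentations.ideleGroup K)) [ν.IsHaarMeasure]
    (g : GL (Fin n) (AdeleRing (𝓞 K) K)) {Φ : (Fin n → AdeleRing (𝓞 K) K) → ℂ}
    (hΦ : IsStandardSchwartzBruhat K n Φ) {σ : ℝ} (hσ : 1 < σ) :
    ∑' p : Projectivization K (Fin n → K),
      ∫⁻ a, (‖Φ ((a : AdeleRing (𝓞 K) K) •
          (ratVec K p.rep ᵥ* (g : Matrix (Fin n) (Fin n) (AdeleRing (𝓞 K) K))))‖ₑ : ℝ≥0∞) *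
        ENNReal.ofReal ((IdeleClassGroup.ideleNorm K a : ℝ) ^ ((n : ℝ) * σ)) ∂ν < ⊤ := by
  haveI := borelSpace_ideleGroup K
  haveI := countable_projectivization K (n := n)
  rcases Nat.eq_zero_or_pos n with rfl | hn
  · haveI : IsEmpty (Projectivization K (Fin 0 → K)) :=
      ⟨fun p => p.rep_nonzero (Subsingleton.elim _ _)⟩
    rw [tsum_empty]
    exact ENNReal.zero_lt_top
  -- the parameters (`D = [K:ℚ]`)
  have hd : 0 < finrank ℚ K := Module.finrank_pos
  have hdR : (0 : ℝ) < finrank ℚ K := Nat.cast_pos.2 hd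
  have hnR : (0 : ℝ) < n := Nat.cast_pos.2 hn
  set τ : ℝ := (n : ℝ) * σ with hτ
  have hτ0 : 0 ≤ τ := by positivity
  set k : ℕ := ⌊(n : ℝ) * finrank ℚ K * σ⌋₊ + 1 with hk'
  have hk : (n : ℝ) * finrank ℚ K * σ < k := by
    rw [hk']
    push_cast
    exact Nat.lt_floor_add_one _
  set θm : ℝ := (n : ℝ) * finrank ℚ K * (1 + σ) / 2 with hθm
  have hndpos : (0 : ℝ) < n * finrank ℚ K := mul_pos hnR hdR
  have hθm1 : (n : ℝ) * finrank ℚ K < θm := by rw [hθm]; nlinarith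
  have hθm2 : θm < (n : ℝ) * finrank ℚ K * σ := by rw [hθm]; nlinarith
  have hθm0 : 0 ≤ θm := by positivity
  have hθmk : θm ≤ k := by linarith
  have hkD : (n : ℝ) * finrank ℚ K < k := by nlinarith
  -- the sup bound and the lattice sums
  obtain ⟨M, c, C, hM0, hc, hCc, hsup⟩ := exists_tsum_enorm_smul_le K g hΦ k
  set Zf : ℝ → ℝ≥0∞ := fun θ => ∑' v : ↥{v : Fin n → K | v ≠ 0 ∧
      vecFinitePart K n (ratVec K v ᵥ* (g : Matrix (Fin n) (Fin n) (AdeleRing (𝓞 K) K))) ∈ C},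
    ENNReal.ofReal (‖vecInfinitePart K n (ratVec K (v : Fin n → K) ᵥ*
      (g : Matrix (Fin n) (Fin n) (AdeleRing (𝓞 K) K)))‖ ^ (-θ)) with hZf
  have hZ : ∀ θ : ℝ, (n : ℝ) * finrank ℚ K < θ → Zf θ < ⊤ := fun θ hθ =>
    tsum_norm_vecInfinitePart_rpow_neg_lt_top K g hCc hθ
  -- Tonelli
  have hmeas : ∀ p : Projectivization K (Fin n → K), Measurable fun a : GaloisRepresentations.ideleGroup K =>
      (‖Φ ((a : AdeleRing (𝓞 K) K) •
          (ratVec K p.rep ᵥ* (g : Matrix (Fin n) (Fin n) (AdeleRing (𝓞 K) K))))‖ₑ : ℝ≥0∞) *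
        ENNReal.ofReal ((IdeleClassGroup.ideleNorm K a : ℝ) ^ τ) :=
    fun p => measurable_enorm_apply_smul_mul K hΦ.continuous _ τ
  rw [← lintegral_tsum fun p => (hmeas p).aemeasurable]
  set F : GaloisRepresentations.ideleGroup K → ℝ≥0∞ := fun a =>
    ∑' p : Projectivization K (Fin n → K),
      (‖Φ ((a : AdeleRing (𝓞 K) K) •
        (ratVec K p.rep ᵥ* (g : Matrix (Fin n) (Fin n) (AdeleRing (𝓞 K) K))))‖ₑ : ℝ≥0∞) *
        ENNReal.ofReal ((IdeleClassGroup.ideleNorm K a : ℝ) ^ τ) with hF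
  -- the radii `r_j = 2^{j/finrank ℚ K}` and the shells
  have hrpos : ∀ j : ℤ, (0 : ℝ) < (2 : ℝ) ^ ((j : ℝ) / finrank ℚ K) := fun j => Real.rpow_pos_of_pos two_pos _
  set r : ℤ → ℝ≥0ˣ := fun j =>
    Units.mk0 ⟨(2 : ℝ) ^ ((j : ℝ) / finrank ℚ K), (hrpos j).le⟩
      (by rw [Ne, ← NNReal.coe_eq_zero]; exact (hrpos j).ne') with hr
  have hrj : ∀ j : ℤ, (((r j : ℝ≥0ˣ) : ℝ≥0) : ℝ) = (2 : ℝ) ^ ((j : ℝ) / finrank ℚ K) := fun j => rfl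
  have hrjd : ∀ j : ℤ, (((r j : ℝ≥0ˣ) : ℝ≥0) : ℝ) ^ finrank ℚ K = (2 : ℝ) ^ (j : ℝ) := fun j => by
    rw [hrj, ← Real.rpow_natCast, ← Real.rpow_mul two_pos.le,
      div_mul_cancel₀ _ (Nat.cast_ne_zero.2 hd.ne')]
  set shell : ℤ → Set (GaloisRepresentations.ideleGroup K) := fun j =>
    {x | (((r j : ℝ≥0ˣ) : ℝ≥0) : ℝ) ^ finrank ℚ K / 2 ≤ (IdeleClassGroup.ideleNorm K x : ℝ) ∧
      (IdeleClassGroup.ideleNorm K x : ℝ) ≤ 4 * (((r j : ℝ≥0ˣ) : ℝ≥0) : ℝ) ^ finrank ℚ K} with hshell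
  have hcover : (univ : Set (GaloisRepresentations.ideleGroup K)) ⊆ ⋃ j, shell j := by
    intro a _
    set x : ℝ := (IdeleClassGroup.ideleNorm K a : ℝ) with hx
    have hx0 : 0 < x := NNReal.coe_pos.2 (pos_iff_ne_zero.2 (ideleNorm_ne_zero a))
    set j : ℤ := ⌊Real.logb 2 x⌋ with hj
    have h1 : (2 : ℝ) ^ (j : ℝ) ≤ x := by
      calc (2 : ℝ) ^ (j : ℝ) ≤ (2 : ℝ) ^ Real.logb 2 x :=
            Real.rpow_le_rpow_of_exponent_le (by norm_num) (Int.floor_le _)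
        _ = x := Real.rpow_logb two_pos (by norm_num) hx0
    have h2 : x < (2 : ℝ) ^ ((j : ℝ) + 1) := by
      calc x = (2 : ℝ) ^ Real.logb 2 x := (Real.rpow_logb two_pos (by norm_num) hx0).symm
        _ < (2 : ℝ) ^ ((j : ℝ) + 1) :=
            Real.rpow_lt_rpow_of_exponent_lt (by norm_num) (Int.lt_floor_add_one _)
    rw [Real.rpow_add_one two_ne_zero] at h2
    refine mem_iUnion.2 ⟨j, ?_, ?_⟩
    · rw [hrjd]
      have : (0 : ℝ) ≤ (2 : ℝ) ^ (j : ℝ) := Real.rpow_nonneg two_pos.le _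
      linarith
    · rw [hrjd]
      have : (0 : ℝ) ≤ (2 : ℝ) ^ (j : ℝ) := Real.rpow_nonneg two_pos.le _
      linarith
  -- the bound on each shell
  have hV : ν (posRealIdeleSegment K * normOneIdeleCover K) < ⊤ :=
    ((isCompact_posRealIdeleSegment K).mul (isCompact_normOneIdeleCover K)).measure_lt_top
  have hshellb : ∀ θ : ℝ, 0 ≤ θ → θ ≤ k → ∀ j : ℤ, ∫⁻ a in shell j, F a ∂ν ≤
      ν (posRealIdeleSegment K * normOneIdeleCover K) *
        ENNReal.ofReal (4 ^ τ * M * c ^ (-θ) * (2 : ℝ) ^ ((j : ℝ) * (τ - θ / finrank ℚ K))) * Zf θ := by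
    intro θ hθ0 hθk j
    have h := setLIntegral_shell_le K ν g hΦ.continuous hsup hτ0 hθ0 hθk (r j)
    rw [hrj, shell_const_eq hc M τ θ hd j] at h
    exact h
  -- the two halves
  have hplus : ∑' m : ℕ, ∫⁻ a in shell (m : ℤ), F a ∂ν < ⊤ := by
    set ρ : ℝ := (2 : ℝ) ^ (τ - k / finrank ℚ K) with hρ
    have hρ0 : 0 ≤ ρ := Real.rpow_nonneg two_pos.le _
    have hρ1 : ρ < 1 := by
      refine Real.rpow_lt_one_of_one_lt_of_neg (by norm_num) ?_
      rw [sub_neg, lt_div_iff₀ hdR, hτ]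
      nlinarith
    have hgeom : ∀ m : ℕ, (2 : ℝ) ^ (((m : ℤ) : ℝ) * (τ - k / finrank ℚ K)) = ρ ^ m := fun m => by
      rw [hρ, ← Real.rpow_natCast, ← Real.rpow_mul two_pos.le, Int.cast_natCast]
      congr 1
      ring
    refine lt_of_le_of_lt (ENNReal.tsum_le_tsum fun m => hshellb k (Nat.cast_nonneg k) le_rfl m) ?_
    refine lt_of_le_of_lt (ENNReal.tsum_le_tsum fun m => le_of_eq ?_)
      (tsum_mul_ofReal_mul_pow_mul_lt_top hV.ne (hZ k hkD).ne
        (A := 4 ^ τ * M * c ^ (-(k : ℝ))) (by positivity) hρ0 hρ1)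
    rw [hgeom m]
  have hminus : ∑' m : ℕ, ∫⁻ a in shell (-(m + 1 : ℤ)), F a ∂ν < ⊤ := by
    set ρ : ℝ := (2 : ℝ) ^ (-(τ - θm / finrank ℚ K)) with hρ
    have hρ0 : 0 ≤ ρ := Real.rpow_nonneg two_pos.le _
    have hρ1 : ρ < 1 := by
      refine Real.rpow_lt_one_of_one_lt_of_neg (by norm_num) ?_
      rw [neg_neg_iff_pos, sub_pos, div_lt_iff₀ hdR, hτ]
      nlinarith
    have hρ1' : ρ ≤ 1 := hρ1.le
    refine lt_of_le_of_lt (ENNReal.tsum_le_tsum fun m => hshellb θm hθm0 hθmk (-(m + 1 : ℤ))) ?_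
    refine lt_of_le_of_lt (ENNReal.tsum_le_tsum fun m => ?_)
      (tsum_mul_ofReal_mul_pow_mul_lt_top hV.ne (hZ θm hθm1).ne
        (A := 4 ^ τ * M * c ^ (-θm)) (by positivity) hρ0 hρ1)
    refine mul_le_mul' (mul_le_mul' le_rfl (ENNReal.ofReal_le_ofReal ?_)) le_rfl
    refine mul_le_mul_of_nonneg_left ?_ (by positivity)
    have hcast : (((-(m + 1 : ℤ)) : ℤ) : ℝ) * (τ - θm / finrank ℚ K) = ((m + 1 : ℕ) : ℝ) * (-(τ - θm / finrank ℚ K)) := by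
      push_cast
      ring
    rw [hcast, mul_comm, Real.rpow_mul two_pos.le, Real.rpow_natCast]
    exact pow_le_pow_of_le_one hρ0 hρ1' (Nat.le_succ m)
  -- assembly
  calc ∫⁻ a, F a ∂ν = ∫⁻ a in univ, F a ∂ν := (setLIntegral_univ F).symm
    _ ≤ ∫⁻ a in ⋃ j, shell j, F a ∂ν := lintegral_mono_set hcover
    _ ≤ ∑' j : ℤ, ∫⁻ a in shell j, F a ∂ν := lintegral_iUnion_le shell F
    _ = ∑' m : ℕ, ∫⁻ a in shell (m : ℤ), F a ∂ν + ∑' m : ℕ, ∫⁻ a in shell (-(m + 1 : ℤ)), F a ∂ν :=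
        tsum_of_nat_of_neg_add_one ENNReal.summable ENNReal.summable
    _ < ⊤ := ENNReal.add_lt_top.2 ⟨hplus, hminus⟩

/-! ### Linearity and the discharge of the named fact -/

/-- **The majorant property is linear in `Φ`**, hence holds on all of `𝒮(𝔸_Kⁿ)` (the span of the
standard functions, `Submodule.span_induction`): every `Φ ∈ 𝒮(𝔸_Kⁿ)` is continuous and
`∑_p ∫ |Φ(a ξ_p g)| |a|^{nσ} dν < ∞` for `σ > 1`. [folklore] -/
theorem continuous_and_tsum_lintegral_lt_top_of_mem [MeasurableSpace (AdeleRing (𝓞 K) K)]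
    [BorelSpace (AdeleRing (𝓞 K) K)] (ν : Measure (GaloisRepresentations.ideleGroup K)) [ν.IsHaarMeasure]
    {Φ : (Fin n → AdeleRing (𝓞 K) K) → ℂ} (hΦ : Φ ∈ adelicSchwartzBruhat K n) :
    Continuous Φ ∧ ∀ σ : ℝ, 1 < σ → ∀ g : GL (Fin n) (AdeleRing (𝓞 K) K),
      ∑' p : Projectivization K (Fin n → K),
        ∫⁻ a, (‖Φ ((a : AdeleRing (𝓞 K) K) •
            (ratVec K p.rep ᵥ* (g : Matrix (Fin n) (Fin n) (AdeleRing (𝓞 K) K))))‖ₑ : ℝ≥0∞) *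
          ENNReal.ofReal ((IdeleClassGroup.ideleNorm K a : ℝ) ^ ((n : ℝ) * σ)) ∂ν < ⊤ := by
  haveI := borelSpace_ideleGroup K
  induction hΦ using Submodule.span_induction with
  | mem Φ hΦ => exact ⟨hΦ.continuous, fun σ hσ g => tsum_lintegral_enorm_smul_lt_top K ν g hΦ hσ⟩
  | zero =>
      refine ⟨continuous_const, fun σ hσ g => ?_⟩
      simp
  | add Φ Ψ _ _ hΦ hΨ =>
      refine ⟨hΦ.1.add hΨ.1, fun σ hσ g => ?_⟩
      calc ∑' p : Projectivization K (Fin n → K),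
            ∫⁻ a, (‖(Φ + Ψ) ((a : AdeleRing (𝓞 K) K) •
              (ratVec K p.rep ᵥ* (g : Matrix (Fin n) (Fin n) (AdeleRing (𝓞 K) K))))‖ₑ : ℝ≥0∞) *
              ENNReal.ofReal ((IdeleClassGroup.ideleNorm K a : ℝ) ^ ((n : ℝ) * σ)) ∂ν
          ≤ ∑' p : Projectivization K (Fin n → K),
            ((∫⁻ a, (‖Φ ((a : AdeleRing (𝓞 K) K) •
              (ratVec K p.rep ᵥ* (g : Matrix (Fin n) (Fin n) (AdeleRing (𝓞 K) K))))‖ₑ : ℝ≥0∞) *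
              ENNReal.ofReal ((IdeleClassGroup.ideleNorm K a : ℝ) ^ ((n : ℝ) * σ)) ∂ν) +
            ∫⁻ a, (‖Ψ ((a : AdeleRing (𝓞 K) K) •
              (ratVec K p.rep ᵥ* (g : Matrix (Fin n) (Fin n) (AdeleRing (𝓞 K) K))))‖ₑ : ℝ≥0∞) *
              ENNReal.ofReal ((IdeleClassGroup.ideleNorm K a : ℝ) ^ ((n : ℝ) * σ)) ∂ν) := by
            refine ENNReal.tsum_le_tsum fun p => ?_
            rw [← lintegral_add_left (measurable_enorm_apply_smul_mul K hΦ.1 _ _)]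
            refine lintegral_mono fun a => ?_
            rw [← add_mul]
            exact mul_le_mul' (enorm_add_le _ _) le_rfl
        _ = _ := ENNReal.tsum_add
        _ < ⊤ := ENNReal.add_lt_top.2 ⟨hΦ.2 σ hσ g, hΨ.2 σ hσ g⟩
  | smul c Φ _ hΦ =>
      refine ⟨hΦ.1.const_smul c, fun σ hσ g => ?_⟩
      calc ∑' p : Projectivization K (Fin n → K),
            ∫⁻ a, (‖(c • Φ) ((a : AdeleRing (𝓞 K) K) •
              (ratVec K p.rep ᵥ* (g : Matrix (Fin n) (Fin n) (AdeleRing (𝓞 K) K))))‖ₑ : ℝ≥0∞) *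
              ENNReal.ofReal ((IdeleClassGroup.ideleNorm K a : ℝ) ^ ((n : ℝ) * σ)) ∂ν
          = ∑' p : Projectivization K (Fin n → K), ‖c‖ₑ *
            ∫⁻ a, (‖Φ ((a : AdeleRing (𝓞 K) K) •
              (ratVec K p.rep ᵥ* (g : Matrix (Fin n) (Fin n) (AdeleRing (𝓞 K) K))))‖ₑ : ℝ≥0∞) *
              ENNReal.ofReal ((IdeleClassGroup.ideleNorm K a : ℝ) ^ ((n : ℝ) * σ)) ∂ν := by
            refine tsum_congr fun p => ?_
            rw [← lintegral_const_mul' _ _ enorm_ne_top]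
            refine lintegral_congr fun a => ?_
            rw [Pi.smul_apply, smul_eq_mul, enorm_mul, mul_assoc]
        _ = ‖c‖ₑ * _ := ENNReal.tsum_mul_left
        _ < ⊤ := ENNReal.mul_lt_top enorm_lt_top (hΦ.2 σ hσ g)

/-- The norm of the Eisenstein kernel: `‖Φ(a x) |a|^{ns}‖ = |Φ(a x)| |a|^{n re s}`. [folklore] -/
theorem enorm_eisensteinKernel (Φ : (Fin n → AdeleRing (𝓞 K) K) → ℂ) (s : ℂ)
    (x : Fin n → AdeleRing (𝓞 K) K) (a : GaloisRepresentations.ideleGroup K) :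
    (‖eisensteinKernel K Φ s x a‖ₑ : ℝ≥0∞) =
      ‖Φ ((a : AdeleRing (𝓞 K) K) • x)‖ₑ *
        ENNReal.ofReal ((IdeleClassGroup.ideleNorm K a : ℝ) ^ ((n : ℝ) * s.re)) := by
  have ha : 0 < (IdeleClassGroup.ideleNorm K a : ℝ) :=
    NNReal.coe_pos.2 (pos_iff_ne_zero.2 (ideleNorm_ne_zero a))
  rw [eisensteinKernel, enorm_mul, ← ofReal_norm (((IdeleClassGroup.ideleNorm K a : ℝ) : ℂ) ^ _),
    Complex.norm_cpow_eq_rpow_re_of_pos ha]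
  congr 3
  simp [Complex.mul_re]

/-- The Eisenstein kernel is continuous on `𝔸_Kˣ` for continuous `Φ`. [folklore] -/
theorem continuous_eisensteinKernel {Φ : (Fin n → AdeleRing (𝓞 K) K) → ℂ} (hΦc : Continuous Φ)
    (s : ℂ) (x : Fin n → AdeleRing (𝓞 K) K) : Continuous (eisensteinKernel K Φ s x) := by
  have hc : Continuous fun a : GaloisRepresentations.ideleGroup K => (IdeleClassGroup.ideleNorm K a : ℝ) :=
    NNReal.continuous_coe.comp (continuous_ideleNorm_holds K)
  show Continuous fun a : GaloisRepresentations.ideleGroup K =>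
    Φ ((a : AdeleRing (𝓞 K) K) • x) * ((IdeleClassGroup.ideleNorm K a : ℝ) : ℂ) ^ ((n : ℂ) * s)
  refine (hΦc.comp (Units.continuous_val.smul continuous_const)).mul ?_
  refine (Complex.continuous_ofReal.comp hc).cpow continuous_const fun a => ?_
  exact Complex.ofReal_mem_slitPlane.2 (NNReal.coe_pos.2 (pos_iff_ne_zero.2 (ideleNorm_ne_zero a)))

section Discharge

variable [MeasurableSpace (AdeleRing (𝓞 K) K)] [BorelSpace (AdeleRing (𝓞 K) K)]

/-- **Absolute convergence of the mirabolic Eisenstein series for `re s > 1`**: the named fact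
`summable_mirabolicEisenstein` of `MirabolicEisensteinSeries` holds — for every Haar measure `ν`
on `𝔸_Kˣ`, `Φ ∈ 𝒮(𝔸_Kⁿ)`, `re s > 1` and `g ∈ GL_n(𝔸_K)`, each Tate-type integral
`∫ Φ(a ξ g) |a|^{ns} dν(a)` converges absolutely and `∑_{ξ ∈ ℙ^{n-1}(K)} ∫ |Φ(a ξ g)| |a|^{n re s} dν(a)`
converges ("This is absolutely convergent for `Re(s) > 1`", Cogdell (2004), §2.3, p. 210;
Jacquet–Shalika (1981), §4). Both clauses follow from the finiteness of the majorant
`∑_p ∫ |Φ(a ξ_p g)| |a|^{n re s} dν` (`continuous_and_tsum_lintegral_lt_top_of_mem`).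
[cite: CogdellAnalyticTheory2004, §2.3, p. 210] [cite: JacquetShalikaAJM1981, §4] -/
theorem summable_mirabolicEisenstein_holds : summable_mirabolicEisenstein K n := by
  intro ν hν Φ hΦ s hs g
  haveI := borelSpace_ideleGroup K
  obtain ⟨hcont, hfin⟩ := continuous_and_tsum_lintegral_lt_top_of_mem K ν hΦ
  have htot := hfin s.re hs g
  set x : Projectivization K (Fin n → K) → Fin n → AdeleRing (𝓞 K) K := fun p =>
    ratVec K p.rep ᵥ* (g : Matrix (Fin n) (Fin n) (AdeleRing (𝓞 K) K)) with hx
  have hker : ∀ p, Continuous (eisensteinKernel K Φ s (x p)) := fun p =>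
    continuous_eisensteinKernel K hcont s (x p)
  have hlint : ∀ p, ∫⁻ a, ‖eisensteinKernel K Φ s (x p) a‖ₑ ∂ν =
      ∫⁻ a, (‖Φ ((a : AdeleRing (𝓞 K) K) • x p)‖ₑ : ℝ≥0∞) *
        ENNReal.ofReal ((IdeleClassGroup.ideleNorm K a : ℝ) ^ ((n : ℝ) * s.re)) ∂ν :=
    fun p => lintegral_congr fun a => enorm_eisensteinKernel K Φ s (x p) a
  refine ⟨fun p => ⟨(hker p).aestronglyMeasurable, ?_⟩, ?_⟩
  · change ∫⁻ a, ‖eisensteinKernel K Φ s (x p) a‖ₑ ∂ν < ⊤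
    rw [hlint p]
    exact lt_of_le_of_lt (ENNReal.le_tsum p) htot
  · have heq : (fun p : Projectivization K (Fin n → K) =>
        ∫ a, ‖eisensteinKernel K Φ s (x p) a‖ ∂ν) = fun p =>
          (∫⁻ a, (‖Φ ((a : AdeleRing (𝓞 K) K) • x p)‖ₑ : ℝ≥0∞) *
            ENNReal.ofReal ((IdeleClassGroup.ideleNorm K a : ℝ) ^ ((n : ℝ) * s.re)) ∂ν).toReal := by
      funext p
      rw [integral_norm_eq_lintegral_enorm (hker p).aestronglyMeasurable, hlint p]
    change Summable fun p : Projectivization K (Fin n → K) => ∫ a, ‖eisensteinKernel K Φ s (x p) a‖ ∂ν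
    rw [heq]
    exact ENNReal.summable_toReal htot.ne

end Discharge

end Literature.NumberTheory.Automorphic
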